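import Literature.Analysis.FluidPDE.HeatFlowLpClass
import Literature.Analysis.FluidPDE.CaloricRemainderCalculus
import Literature.Analysis.UnboundedOperators.HeatKernelBoundedData
import Literature.Analysis.UnboundedOperators.HeatExtensionJointSmooth
import Literature.Analysis.FluidPDE.NSBoundedMildOseenClassical
import HarnessLib

/-!
# The caloric field `e(t) = e^{νtΔ}u₀` of bounded `L³` data: bounds, smoothness, the heat
# equation, divergence, and its smooth cut-off in time

Analysis/FluidPDE support file (theorems only) for the Calderón / Rusin–Šverák route to the far-field
regularity of Kato's mild `L³` solution near the blow-up time
(`Literature.Analysis.FluidPDE.IsKatoSolutionOn.farField_bound`; W. Rusin, V. Šverák, J. Funct.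
Anal. 260 (2011) = arXiv:0911.0500, §4 p. 6: "`u = a + v`"; C. P. Calderón, Trans. AMS 318 (1990),
§1; P. G. Lemarié-Rieusset, *The Navier–Stokes problem in the 21st century* (2016), Prop. 15.1:
the mild solution is compared with the free evolution `e^{νtΔ}u₀`). The local energy inequality of
the caloric remainder (`CaloricRemainderLocalEnergy.lean`) is applied with the field
`e(t, x) = e^{νtΔ}u₀(x)` of a *bounded* `L³` datum (the slice of the Kato solution at a restart
time); this file packages the properties of `e` that are fed into it:

* `norm_heatFlow_le_of_bound` — `|e(t, x)| ≤ M` if `|u₀| ≤ M` (maximum principle);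
* `norm_fderiv_heatFlow_le_of_bound` — `‖De(t, x)‖ ≤ 2^{3/2} (νt)^{-1/2} M` on `ℝ³`
  (the tree's `norm_fderiv_heatExtension_le_of_bounded`);
* `contDiffOn_uncurry_heatFlow` — joint smoothness of `(t, x) ↦ e(t, x)` on `(0, ∞) × E`;
  `hasDerivAt_heatFlow_time` — the heat equation `∂ₜe = νΔe` for `t > 0`;
  `isDivFree_heatFlow_of_pos` — `div e(t) = 0` classically for `t > 0` and weakly divergence-free
  `u₀`;
* the **smooth cut-off in time** `ẽ(t, x) = ST(4t/τ - 1) e(t, x)` (`τ > 0`; `Real.smoothTransition`),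
  which is globally `C^∞`, equals `e` for `t ≥ τ/2`, vanishes for `t ≤ τ/4`, solves the heat
  equation on the slab `(τ/2, ∞) × E` and is divergence free at all times
  (`contDiff_uncurry_cutoffHeatFlow`, `cutoffHeatFlow_eq_of_le`, `hasDerivAt_cutoffHeatFlow_time`,
  `isDivFree_cutoffHeatFlow`) — the globally smooth field required by
  `caloric_remainder_energy_inequality`;
* `ContinuousInLpOn.sub` and the continuity of the weighted energies `t ↦ ∫ |w(t)|² ω` of a
  `C(S; L³)` field against a bounded compactly supported weight
  (`ContinuousInLpOn.continuousOn_integral_norm_sq_mul`).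

## Mathlib / tree search

Tree: `heatFlow`, `heatFlow_of_pos`, `heatFlow_of_nonpos` (`MildSolution.lean`);
`continuousInLpOn_heatFlow`, `IsWeaklyDivFree.heatFlow_of_memLp`,
`aestronglyMeasurable_uncurry_heatFlow` (`HeatFlowLpClass.lean`);
`UnboundedOperators.norm_heatExtension_le`, `norm_fderiv_heatExtension_le_of_bounded`
(`HeatKernelBoundedData.lean`), `contDiffOn_heatExtension_prod` (`HeatExtensionJointSmooth.lean`),
`hasDerivAt_heatExtension_time` (`HeatKernelHeatEquation.lean`), `contDiff_heatExtension_holds`,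
`IsWeaklyDivFree.isDivFree_of_contDiff` (`NSBoundedMildOseenClassical.lean`);
`ContinuousInLpOn.exists_forall_eLpNorm_le` (`KatoL3Uniqueness.lean`). Mathlib:
`Real.smoothTransition`, `HasDerivAt.scomp`, `ContDiffOn.smul`, `contDiff_iff_contDiffAt`,
`ENNReal.lintegral_mul_le_Lp_mul_Lq`.

## References

* W. Rusin, V. Šverák, J. Funct. Anal. 260 (2011) 879–891 = arXiv:0911.0500, §4 p. 6.
  [RusinSverak2011]
* P. G. Lemarié-Rieusset, *The Navier–Stokes problem in the 21st century*, CRC Press 2016,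
  Prop. 15.1; Thm. 14.7 (proof). [LemarieRieusset2016]
-/

noncomputable section

open MeasureTheory TopologicalSpace Set Function Filter Topology Metric Real
open scoped ENNReal NNReal RealInnerProductSpace Laplacian

namespace Literature.Analysis.FluidPDE

section HeatFlowBounded

variable {E : Type*} [NormedAddCommGroup E] [InnerProductSpace ℝ E] [FiniteDimensional ℝ E]
  [MeasurableSpace E] [BorelSpace E]
variable {F : Type*} [NormedAddCommGroup F] [NormedSpace ℝ F] [CompleteSpace F]

omit [CompleteSpace F] in
/-- **Maximum principle for the heat flow**: `|e^{τΔ}u₀(x)| ≤ M` for all `τ ≥ 0` (indeed all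
`τ`) if `|u₀| ≤ M` pointwise. [folklore] -/
theorem norm_heatFlow_le_of_bound {u₀ : E → F} {M : ℝ} (hM : ∀ x, ‖u₀ x‖ ≤ M) (τ : ℝ) (x : E) :
    ‖heatFlow u₀ τ x‖ ≤ M := by
  rcases le_or_gt τ 0 with hτ | hτ
  · rw [heatFlow_of_nonpos _ hτ]; exact hM x
  · rw [heatFlow_of_pos _ hτ]; exact UnboundedOperators.norm_heatExtension_le hM hτ x

/-- **Gradient bound for the heat flow of bounded data**: `‖D(e^{τΔ}u₀)(x)‖ ≤ 2^{d/2} τ^{-1/2} M`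
for `τ > 0` if `|u₀| ≤ M` (and `u₀` is measurable). [folklore] -/
theorem norm_fderiv_heatFlow_le_of_bound {u₀ : E → F} (hu₀ : AEStronglyMeasurable u₀ volume)
    {M : ℝ} (hM : ∀ x, ‖u₀ x‖ ≤ M) {τ : ℝ} (hτ : 0 < τ) (x : E) :
    ‖fderiv ℝ (heatFlow u₀ τ) x‖ ≤ 2 ^ ((Module.finrank ℝ E : ℝ) / 2) * τ ^ (-(1 / 2 : ℝ)) * M := by
  rw [heatFlow_of_pos _ hτ]
  exact UnboundedOperators.norm_fderiv_heatExtension_le_of_bounded hu₀ hM hτ x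

omit [CompleteSpace F] in
/-- **Joint smoothness of the free evolution** `(t, x) ↦ e^{νtΔ}u₀(x)` on `(0, ∞) × E` for `u₀ ∈ Lᵖ`,
`1 ≤ p`, `ν > 0`. [folklore] -/
theorem contDiffOn_uncurry_heatFlow {u₀ : E → F} {p : ℝ≥0∞} (hu₀ : MemLp u₀ p volume) (hp : 1 ≤ p)
    {ν : ℝ} (hν : 0 < ν) :
    ContDiffOn ℝ ((⊤ : ℕ∞) : WithTop ℕ∞) (fun q : ℝ × E => heatFlow u₀ (ν * q.1) q.2) (Ioi 0 ×ˢ univ) := by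
  have h := UnboundedOperators.contDiffOn_heatExtension_prod hu₀ hp
  have hmap : ContDiff ℝ ((⊤ : ℕ∞) : WithTop ℕ∞) fun q : ℝ × E => ((ν * q.1, q.2) : ℝ × E) :=
    (contDiff_const.mul contDiff_fst).prodMk contDiff_snd
  have hmaps : MapsTo (fun q : ℝ × E => ((ν * q.1, q.2) : ℝ × E)) (Ioi 0 ×ˢ univ) (Ioi 0 ×ˢ univ) :=
    fun q hq => ⟨mul_pos hν hq.1, mem_univ _⟩
  refine (h.comp hmap.contDiffOn hmaps).congr fun q hq => ?_
  exact congrFun (heatFlow_of_pos u₀ (mul_pos hν hq.1)) q.2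

/-- **The heat equation for the free evolution**: `∂ₜ e^{νtΔ}u₀(x) = ν Δ(e^{νtΔ}u₀)(x)` for `t > 0`,
`ν > 0`, `u₀ ∈ Lᵖ`. [folklore] -/
theorem hasDerivAt_heatFlow_time {u₀ : E → F} {p : ℝ≥0∞} (hu₀ : MemLp u₀ p volume) (hp : 1 ≤ p)
    {ν t : ℝ} (hν : 0 < ν) (ht : 0 < t) (x : E) :
    HasDerivAt (fun s => heatFlow u₀ (ν * s) x) (ν • (Δ (heatFlow u₀ (ν * t))) x) t := by
  have h1 : HasDerivAt (fun σ => UnboundedOperators.heatExtension u₀ σ x) ((Δ (UnboundedOperators.heatExtension u₀ (ν * t))) x) (ν * t) :=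
    UnboundedOperators.hasDerivAt_heatExtension_time (mul_pos hν ht) hu₀ hp x
  have h2 : HasDerivAt (fun s : ℝ => ν * s) ν t := by
    simpa using (hasDerivAt_id t).const_mul ν
  have h3 := h1.scomp t h2
  rw [heatFlow_of_pos _ (mul_pos hν ht)]
  refine h3.congr_of_eventuallyEq ?_
  filter_upwards [(isOpen_Ioi (a := (0 : ℝ))).mem_nhds ht] with s hs
  exact congrFun (heatFlow_of_pos u₀ (mul_pos hν hs)) x

/-- For weakly divergence-free `u₀ ∈ Lᵖ` and `τ > 0` the slice `e^{τΔ}u₀` is classically divergence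
free. [folklore] -/
theorem isDivFree_heatFlow_of_pos {u₀ : E → E} (hdiv : IsWeaklyDivFree u₀) {p : ℝ≥0∞}
    (hu₀ : MemLp u₀ p volume) (hp : 1 ≤ p) {τ : ℝ} (hτ : 0 < τ) :
    VectorCalculus.IsDivFree (heatFlow u₀ τ) := by
  have hw : IsWeaklyDivFree (heatFlow u₀ τ) := hdiv.heatFlow_of_memLp hp hu₀ τ
  have hs : ContDiff ℝ 1 (heatFlow u₀ τ) := by
    rw [heatFlow_of_pos _ hτ]
    exact contDiff_infty.1 (UnboundedOperators.contDiff_heatExtension_holds hu₀ hp hτ) 1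
  exact hw.isDivFree_of_contDiff hs

end HeatFlowBounded

/-! ### The smooth cut-off in time of the free evolution -/

section Cutoff

variable {E : Type*} [NormedAddCommGroup E] [InnerProductSpace ℝ E] [FiniteDimensional ℝ E]
  [MeasurableSpace E] [BorelSpace E]
variable {F : Type*} [NormedAddCommGroup F] [NormedSpace ℝ F] [CompleteSpace F]

/-- The time cut-off `ST(4t/τ - 1)` vanishes for `t ≤ τ/4`. [folklore] -/
theorem smoothTransition_timeCutoff_eq_zero {τ t : ℝ} (hτ : 0 < τ) (ht : t ≤ τ / 4) :
    smoothTransition (4 * t / τ - 1) = 0 := by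
  refine smoothTransition.zero_of_nonpos ?_
  have : 4 * t / τ ≤ 1 := by rw [div_le_one hτ]; linarith
  linarith

/-- The time cut-off `ST(4t/τ - 1)` equals `1` for `t ≥ τ/2`. [folklore] -/
theorem smoothTransition_timeCutoff_eq_one {τ t : ℝ} (hτ : 0 < τ) (ht : τ / 2 ≤ t) :
    smoothTransition (4 * t / τ - 1) = 1 := by
  refine smoothTransition.one_of_one_le ?_
  have : (2 : ℝ) ≤ 4 * t / τ := by rw [le_div_iff₀ hτ]; linarith
  linarith

omit [CompleteSpace F] in
/-- **The cut-off free evolution is globally smooth**: `(t, x) ↦ ST(4t/τ - 1) e^{νtΔ}u₀(x)` is `C^∞`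
on `ℝ × E` (`τ, ν > 0`, `u₀ ∈ Lᵖ`): a product of smooth functions where `t > 0`, identically zero
near `t ≤ τ/4`. [folklore] -/
theorem contDiff_uncurry_cutoffHeatFlow {u₀ : E → F} {p : ℝ≥0∞} (hu₀ : MemLp u₀ p volume) (hp : 1 ≤ p)
    {ν τ : ℝ} (hν : 0 < ν) (hτ : 0 < τ) :
    ContDiff ℝ (⊤ : ℕ∞) (uncurry fun t x => smoothTransition (4 * t / τ - 1) • heatFlow u₀ (ν * t) x) := by
  have hρ : ContDiff ℝ (⊤ : ℕ∞) fun t : ℝ => smoothTransition (4 * t / τ - 1) :=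
    smoothTransition.contDiff.comp (((contDiff_const.mul contDiff_id).div_const τ).sub contDiff_const)
  have hU : IsOpen (Ioi (0 : ℝ) ×ˢ (univ : Set E)) := isOpen_Ioi.prod isOpen_univ
  refine contDiff_iff_contDiffAt.2 fun z => ?_
  by_cases hz : τ / 8 < z.1
  · have hz0 : z ∈ Ioi (0 : ℝ) ×ˢ (univ : Set E) := ⟨lt_trans (by positivity) hz, mem_univ _⟩
    have h1 : ContDiffAt ℝ (⊤ : ℕ∞) (fun q : ℝ × E => heatFlow u₀ (ν * q.1) q.2) z :=
      (contDiffOn_uncurry_heatFlow hu₀ hp hν).contDiffAt (hU.mem_nhds hz0)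
    exact ((hρ.comp contDiff_fst).contDiffAt).smul h1
  · have hev : (uncurry fun t x => smoothTransition (4 * t / τ - 1) • heatFlow u₀ (ν * t) x) =ᶠ[𝓝 z]
        fun _ => 0 := by
      have ho : IsOpen {q : ℝ × E | q.1 < τ / 4} := isOpen_lt continuous_fst continuous_const
      have hzmem : z ∈ {q : ℝ × E | q.1 < τ / 4} := by
        show z.1 < τ / 4
        linarith [not_lt.1 hz]
      filter_upwards [ho.mem_nhds hzmem] with q hq
      have hq' : q.1 ≤ τ / 4 := le_of_lt hq
      simp [uncurry, smoothTransition_timeCutoff_eq_zero hτ hq']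
    exact (contDiffAt_const (c := (0 : F))).congr_of_eventuallyEq hev

omit [CompleteSpace F] in
/-- For `t ≥ τ/2` the cut-off free evolution is the free evolution. [folklore] -/
theorem cutoffHeatFlow_eq_of_le {u₀ : E → F} {ν τ t : ℝ} (hτ : 0 < τ) (ht : τ / 2 ≤ t) (x : E) :
    smoothTransition (4 * t / τ - 1) • heatFlow u₀ (ν * t) x = heatFlow u₀ (ν * t) x := by
  rw [smoothTransition_timeCutoff_eq_one hτ ht, one_smul]

/-- **The cut-off free evolution solves the heat equation where the cut-off is `1`**:
`∂ₜẽ = νΔẽ` at every `(t, x)` with `t > τ/2`. [folklore] -/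
theorem hasDerivAt_cutoffHeatFlow_time {u₀ : E → F} {p : ℝ≥0∞} (hu₀ : MemLp u₀ p volume) (hp : 1 ≤ p)
    {ν τ t : ℝ} (hν : 0 < ν) (hτ : 0 < τ) (ht : τ / 2 < t) (x : E) :
    HasDerivAt (fun s => smoothTransition (4 * s / τ - 1) • heatFlow u₀ (ν * s) x)
      (ν • (Δ (fun y => smoothTransition (4 * t / τ - 1) • heatFlow u₀ (ν * t) y)) x) t := by
  have ht0 : 0 < t := lt_trans (by positivity) ht
  have hslice : (fun y => smoothTransition (4 * t / τ - 1) • heatFlow u₀ (ν * t) y) = heatFlow u₀ (ν * t) :=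
    funext fun y => cutoffHeatFlow_eq_of_le hτ ht.le y
  rw [hslice]
  refine (hasDerivAt_heatFlow_time hu₀ hp hν ht0 x).congr_of_eventuallyEq ?_
  filter_upwards [(isOpen_Ioi (a := τ / 2)).mem_nhds ht] with s hs
  exact cutoffHeatFlow_eq_of_le hτ (le_of_lt hs) x

omit [CompleteSpace F] in
/-- **The cut-off free evolution is divergence free at all times** (weakly divergence-free
`u₀ ∈ Lᵖ`, `ν, τ > 0`): for `t ≤ τ/4` it vanishes, for `t > 0` it is a constant multiple of the
divergence-free slice `e^{νtΔ}u₀`. [folklore] -/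
theorem isDivFree_cutoffHeatFlow {u₀ : E → E} (hdiv : IsWeaklyDivFree u₀) {p : ℝ≥0∞}
    (hu₀ : MemLp u₀ p volume) (hp : 1 ≤ p) {ν τ : ℝ} (hν : 0 < ν) (hτ : 0 < τ) (t : ℝ) :
    VectorCalculus.IsDivFree fun y => smoothTransition (4 * t / τ - 1) • heatFlow u₀ (ν * t) y := by
  intro x
  by_cases ht : t ≤ τ / 4
  · simp only [smoothTransition_timeCutoff_eq_zero hτ ht, zero_smul]
    simp [VectorCalculus.divergence]
  · have ht0 : 0 < t := lt_of_lt_of_le (by positivity) (not_le.1 ht).le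
    have hdf := isDivFree_heatFlow_of_pos hdiv hu₀ hp (mul_pos hν ht0) x
    have hd : DifferentiableAt ℝ (heatFlow u₀ (ν * t)) x := by
      rw [heatFlow_of_pos _ (mul_pos hν ht0)]
      exact (UnboundedOperators.contDiff_heatExtension_holds hu₀ hp (mul_pos hν ht0)).differentiable (by simp) x
    have : (fun y => smoothTransition (4 * t / τ - 1) • heatFlow u₀ (ν * t) y) =
        smoothTransition (4 * t / τ - 1) • heatFlow u₀ (ν * t) := rfl
    rw [this, VectorCalculus.divergence, fderiv_const_smul hd]
    rw [VectorCalculus.divergence] at hdf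
    simp [hdf]

end Cutoff

/-! ### `C(S; Lᵖ)` fields: differences and weighted energies -/

section Continuity

variable {X : Type*} [MeasureSpace X] {F : Type*} [NormedAddCommGroup F]

/-- Differences of `C(S; Lᵖ)` fields are `C(S; Lᵖ)` (`1 ≤ p`). [folklore] -/
theorem ContinuousInLpOn.sub {S : Set ℝ} {p : ℝ≥0∞} (hp : 1 ≤ p) {u w : ℝ → X → F}
    (hu : ContinuousInLpOn S p u) (hw : ContinuousInLpOn S p w) :
    ContinuousInLpOn S p (fun t x => u t x - w t x) := by
  refine ⟨fun t ht => (hu.1 t ht).sub (hw.1 t ht), fun t₀ ht₀ => ?_⟩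
  have h := (hu.2 t₀ ht₀).add (hw.2 t₀ ht₀)
  rw [add_zero] at h
  refine tendsto_of_tendsto_of_tendsto_of_le_of_le' tendsto_const_nhds h
    (Eventually.of_forall fun t => zero_le) ?_
  filter_upwards [self_mem_nhdsWithin] with t ht
  have e1 : (fun x => u t x - w t x) - (fun x => u t₀ x - w t₀ x) = (u t - u t₀) - (w t - w t₀) := by
    funext x; simp only [Pi.sub_apply]; abel
  rw [e1]
  exact eLpNorm_sub_le ((hu.1 t ht).sub (hu.1 t₀ ht₀)).aestronglyMeasurable
    ((hw.1 t ht).sub (hw.1 t₀ ht₀)).aestronglyMeasurable hp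

end Continuity

section WeightedEnergy

variable {X : Type*} [MeasureSpace X] {F : Type*} [NormedAddCommGroup F] [NormedSpace ℝ F]

omit [NormedSpace ℝ F] in
/-- For `f ∈ L²`, `∫ ‖f‖² = ‖f‖₂²`. [folklore] -/
private theorem integral_norm_sq_eq_toReal_sq {f : X → F} (hf : MemLp f 2 (volume : Measure X)) :
    ∫ x, ‖f x‖ ^ 2 = (eLpNorm f 2 (volume : Measure X)).toReal ^ 2 := by
  have hint : Integrable (fun x => ‖f x‖ ^ 2) (volume : Measure X) := hf.integrable_norm_pow two_ne_zero
  have h1 : ENNReal.ofReal (∫ x, ‖f x‖ ^ 2) = ∫⁻ x, ‖f x‖ₑ ^ 2 := by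
    rw [ofReal_integral_eq_lintegral_ofReal hint (Eventually.of_forall fun _ => sq_nonneg _)]
    refine lintegral_congr fun x => ?_
    rw [← ofReal_norm, ENNReal.ofReal_pow (norm_nonneg _)]
  have h2 : ∫⁻ x, ‖f x‖ₑ ^ 2 = eLpNorm f 2 (volume : Measure X) ^ 2 := by
    have h := lintegral_rpow_enorm_eq_rpow_eLpNorm' (μ := (volume : Measure X)) (f := f)
      (q := (2 : ℝ)) two_pos
    rw [eLpNorm_eq_eLpNorm' two_ne_zero ENNReal.ofNat_ne_top, ENNReal.toReal_ofNat]
    simpa using h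
  have h3 : ∫ x, ‖f x‖ ^ 2 = (ENNReal.ofReal (∫ x, ‖f x‖ ^ 2)).toReal :=
    (ENNReal.toReal_ofReal (integral_nonneg fun _ => sq_nonneg _)).symm
  rw [h3, h1, h2, ENNReal.toReal_pow]

omit [NormedSpace ℝ F] in
/-- **`L²`-continuity gives continuity of `t ↦ ∫ |W(t)|²`.** [folklore] -/
theorem ContinuousInLpOn.continuousOn_integral_norm_sq {S : Set ℝ} {W : ℝ → X → F}
    (hc : ContinuousInLpOn S 2 W) : ContinuousOn (fun t => ∫ x, ‖W t x‖ ^ 2) S := by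
  intro t₀ ht₀
  set a : ℝ → ℝ := fun t => (eLpNorm (W t) 2 volume).toReal with ha
  have h0 : MemLp (W t₀) 2 volume := hc.1 t₀ ht₀
  have hd : Tendsto (fun t => (eLpNorm (W t - W t₀) 2 volume).toReal) (𝓝[S] t₀) (𝓝 0) := by
    have := (ENNReal.tendsto_toReal ENNReal.zero_ne_top).comp (hc.2 t₀ ht₀)
    rwa [ENNReal.toReal_zero] at this
  have hat : Tendsto a (𝓝[S] t₀) (𝓝 (a t₀)) := by
    rw [tendsto_iff_norm_sub_tendsto_zero]
    refine squeeze_zero' (Eventually.of_forall fun t => norm_nonneg _) ?_ hd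
    filter_upwards [eventually_mem_nhdsWithin] with t ht
    have hmt : MemLp (W t) 2 volume := hc.1 t ht
    rw [Real.norm_eq_abs, ha]
    dsimp only
    have h1 : eLpNorm (W t) 2 volume ≤ eLpNorm (W t - W t₀) 2 volume + eLpNorm (W t₀) 2 volume := by
      have := eLpNorm_add_le (hmt.sub h0).aestronglyMeasurable h0.aestronglyMeasurable one_le_two
      rwa [sub_add_cancel] at this
    have h2 : eLpNorm (W t₀) 2 volume ≤ eLpNorm (W t - W t₀) 2 volume + eLpNorm (W t) 2 volume := by
      have := eLpNorm_add_le (h0.sub hmt).aestronglyMeasurable hmt.aestronglyMeasurable one_le_two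
      rw [sub_add_cancel, eLpNorm_sub_comm] at this
      exact this
    have hfin1 : eLpNorm (W t - W t₀) 2 volume ≠ ∞ := (hmt.sub h0).eLpNorm_ne_top
    have e1 := ENNReal.toReal_mono (ENNReal.add_ne_top.2 ⟨hfin1, h0.eLpNorm_ne_top⟩) h1
    have e2 := ENNReal.toReal_mono (ENNReal.add_ne_top.2 ⟨hfin1, hmt.eLpNorm_ne_top⟩) h2
    rw [ENNReal.toReal_add hfin1 h0.eLpNorm_ne_top] at e1
    rw [ENNReal.toReal_add hfin1 hmt.eLpNorm_ne_top] at e2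
    rw [abs_le]
    constructor <;> linarith
  have heq : ∀ t ∈ S, ∫ x, ‖W t x‖ ^ 2 = a t ^ 2 := fun t ht =>
    integral_norm_sq_eq_toReal_sq (hc.1 t ht)
  have hlim : Tendsto (fun t => a t ^ 2) (𝓝[S] t₀) (𝓝 (a t₀ ^ 2)) := hat.pow 2
  show Tendsto (fun t => ∫ x, ‖W t x‖ ^ 2) (𝓝[S] t₀) (𝓝 (∫ x, ‖W t₀ x‖ ^ 2))
  rw [heq t₀ ht₀]
  refine hlim.congr' ?_
  filter_upwards [eventually_mem_nhdsWithin] with t ht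
  exact (heq t ht).symm

/-- **Multiplication by an `L⁶` weight maps `C(S; L³)` to `C(S; L²)`** (Hölder `6, 3, 2`):
with `θ = √χ` for a cut-off `χ`, this makes the localised energies `t ↦ ∫ |w(t)|² χ` of a
`C(S; L³)` field continuous (`ContinuousInLpOn.continuousOn_integral_norm_sq`). [folklore] -/
theorem ContinuousInLpOn.smul_memLp_six {S : Set ℝ} {w : ℝ → X → F} (hc : ContinuousInLpOn S 3 w)
    {θ : X → ℝ} (hθ : MemLp θ 6 (volume : Measure X)) :
    ContinuousInLpOn S 2 fun t x => θ x • w t x := by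
  haveI : ENNReal.HolderTriple 6 3 2 := ENNReal.HolderTriple.of_toReal (by norm_num [Real.holderTriple_iff])
  refine ⟨fun t ht => ?_, fun t₀ ht₀ => ?_⟩
  · exact MemLp.smul (r := 2) (hc.1 t ht) hθ
  · have h := hc.2 t₀ ht₀
    have hbound : ∀ t ∈ S, eLpNorm ((fun x => θ x • w t x) - fun x => θ x • w t₀ x) 2 volume ≤
        eLpNorm θ 6 volume * eLpNorm (w t - w t₀) 3 volume := by
      intro t ht
      have e1 : ((fun x => θ x • w t x) - fun x => θ x • w t₀ x) = θ • (w t - w t₀) := by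
        funext x; simp [smul_sub]
      rw [e1]
      exact eLpNorm_smul_le_mul_eLpNorm ((hc.1 t ht).sub (hc.1 t₀ ht₀)).aestronglyMeasurable
        hθ.aestronglyMeasurable
    have hlim : Tendsto (fun t => eLpNorm θ 6 volume * eLpNorm (w t - w t₀) 3 volume) (𝓝[S] t₀) (𝓝 0) := by
      have := ENNReal.Tendsto.const_mul h (Or.inr hθ.eLpNorm_ne_top)
      rwa [mul_zero] at this
    refine tendsto_of_tendsto_of_tendsto_of_le_of_le' tendsto_const_nhds hlim
      (Eventually.of_forall fun t => zero_le) ?_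
    filter_upwards [self_mem_nhdsWithin] with t ht
    exact hbound t ht

end WeightedEnergy

end Literature.Analysis.FluidPDE
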